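import Mathlib
import HarnessLib
import Summits.CriticalPhenomena.Statement
import Literature.Probability.RandomPlanarGeometry.RestrictionHulls
import Summits.CriticalPhenomena.SAWScalingLimit.Theorems.SAWLoopFugacityFlowSimpleSubseqLimitsBoundaryPassage
import Summits.CriticalPhenomena.SAWScalingLimit.Theorems.SAWLoopFugacityFlowSimpleSubseqLimitsFirstHitPassage

/-!
# Scratch (lead c3): the promotable lattice statement in ROUTE-FILE vocabulary

Elaboration check that the self-contained statement `LatticeInputs` (Theorems file
`…SimpleSubseqLimitsLatticeLine.lean`, §4), written with FULLY QUALIFIED Literature names exactly as a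
route item signature must be, elaborates in the import/open context of the route file
`Theses/SAWLoopFugacityFlow.lean` (same four imports, same `open` lines). Not for landing.
-/

open scoped BigOperators Topology Manifold Classical MeasureTheory ProbabilityTheory Matrix InnerProductSpace ComplexConjugate ContinuousMap
open Filter Set Function TopologicalSpace MeasureTheory

/-- The item text (paste as the signature of the promoted item). -/
def SAWLatticeRegularity : Prop :=
  (∀ (D : Literature.Probability.RandomPlanarGeometry.DobrushinDomain) (a b : ℝ → Literature.Probability.LatticeModels.Site 2), Literature.Probability.RandomPlanarGeometry.SAW.IsEndpointApprox D a b → ∀ (q : ℂ) (r ρ θ : ℝ), 0 < r → 0 < ρ → 0 < θ → ∃ ε r' : ℝ, 0 < ε ∧ r < r' ∧ ∀ᶠ δ in nhdsWithin 0 (Set.Ioi 0), Literature.Probability.RandomPlanarGeometry.SAW.law D.carrier δ (a δ) (b δ) {γ | ∃ γ' : Literature.Probability.RandomPlanarGeometry.Curve ℂ, Literature.Probability.RandomPlanarGeometry.CurveClass.mk γ' = γ.curve ∧ ∃ v T t' : unitInterval, v < T ∧ T ≤ t' ∧ (∀ u : unitInterval, u ≤ v → r < dist (γ' u) q) ∧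 dist (γ' T) q < r' ∧ ρ < dist (γ' v) (γ' T) ∧ dist (γ' t') (γ' v) < ε} ≤ ENNReal.ofReal θ) ∧
  (∀ (D : Literature.Probability.RandomPlanarGeometry.DobrushinDomain) (a b : ℝ → Literature.Probability.LatticeModels.Site 2), Literature.Probability.RandomPlanarGeometry.SAW.IsEndpointApprox D a b → ∀ ρ θ : ℝ, 0 < ρ → 0 < θ → ∃ ε : ℝ, 0 < ε ∧ ∀ᶠ δ in nhdsWithin 0 (Set.Ioi 0), Literature.Probability.RandomPlanarGeometry.SAW.law D.carrier δ (a δ) (b δ) {γ | ∃ γ' : Literature.Probability.RandomPlanarGeometry.Curve ℂ, Literature.Probability.RandomPlanarGeometry.CurveClass.mk γ' = γ.curve ∧ ∃ t : unitInterval, Metric.infDist (γ' t) (frontier D.carrier) < ε ∧ ρ < dist (γ' t) (D.pt 0) ∧ ρ < dist (γ' t) (D.pt 1)} ≤ ENNReal.ofReal θ)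

-- the item text IS `FirstHitDecay ∧ BoundaryDecay` (definitional; `Boundary.Line.LatticeInputs` of p131674 is the
-- same term written with the Theorems files' `open`s, `latticeInputs_iff := Iff.rfl` there)
example : SAWLatticeRegularity ↔
    (Summit.CriticalPhenomena.SAWScalingLimit.Theorems.SimpleSubseqLimits.FirstHit.Passage.FirstHitDecay ∧
      Summit.CriticalPhenomena.SAWScalingLimit.Theorems.SimpleSubseqLimits.Boundary.Passage.BoundaryDecay) :=
  Iff.rfl
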